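import Summits.AtomisticToContinuum.Crystallization.Theses.DisclinationRation

/-!
# Sketch — crux-ideate, ideator 1, crux `DisclinationRation.FiveFoldRation` (stmt-AtomisticToContinuum-15799)

First lemmas of the two idea cards of this seat, stated over existing declarations (the crux's own
inline shell predicates, copied verbatim as `GA` / `GF` so that `fiveFoldRation_iff` is `Iff.rfl`).

* card `stationary-flatness`  — `StationaryAxisFree` (C⁺) and the correspondence bridge
  `Correspondence : StationaryAxisFree → FiveFoldRation` (Furstenberg averaging over the offending balls).
* card `regge-petrunin-pattern-complex` — `ShellMutual` (front end, first local lemma),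
  `LinearAxisCensus` (C⁺, codimension-two rate) and the PROVED bridge
  `fiveFoldRation_of_linearAxisCensus : LinearAxisCensus → FiveFoldRation`.
-/

namespace Summit.AtomisticToContinuum.Crystallization.Cruxes.FiveFoldRation.IdeatorOne

open scoped BigOperators Topology Classical MeasureTheory Matrix InnerProductSpace
open Filter Set Function MeasureTheory

/-- Ambient space. -/
abbrev E3 := EuclideanSpace ℝ (Fin 3)

/-- The 12-point decahedral-axis pattern (bicapped pentagonal prism), verbatim from the crux. -/
def decaPattern : Set E3 :=
  {p : E3 | p = !₂[(0 : ℝ), 0, 1] ∨ p = !₂[(0 : ℝ), 0, -1] ∨ ∃ k : Fin 5, ∃ σ : ℝ, (σ = 1 / 2 ∨ σ = -(1 / 2)) ∧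
    p = !₂[Real.sqrt 3 / 2 * Real.cos (2 * Real.pi * (k : ℝ) / 5), Real.sqrt 3 / 2 * Real.sin (2 * Real.pi * (k : ℝ) / 5), σ]}

/-- Nearest-neighbour distance `d_y` (verbatim the crux's `let d`). -/
noncomputable def nnDist (S : Set E3) (y : E3) : ℝ := sInf ((fun z => dist z y) '' (S \ {y}))

/-- First shell `T_y = {z ∈ S : 0 < |z − y| < 13/10·d_y}` (verbatim the crux's `let T`). -/
def shell (S : Set E3) (y : E3) : Set E3 := {z : E3 | z ∈ S ∧ z ≠ y ∧ dist z y < 13 / 10 * nnDist S y}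

/-- Alphabet-goodness `GA` of the crux: shell `1/20`-matched to fcc, hcp or the decahedral-axis pattern. -/
def GA (S : Set E3) (y : E3) : Prop :=
  let d : ℝ := sInf ((fun z => dist z y) '' (S \ {y})); let T : Set (EuclideanSpace ℝ (Fin 3)) := {z : EuclideanSpace ℝ (Fin 3) | z ∈ S ∧ z ≠ y ∧ dist z y < 13 / 10 * d}; ∃ A : EuclideanSpace ℝ (Fin 3) →ₗᵢ[ℝ] EuclideanSpace ℝ (Fin 3), (∃ e : ↥T ≃ ↥Literature.Geometry.DiscreteGeometry.fccKissingPattern, ∀ t : ↥T, dist (d⁻¹ • ((t : EuclideanSpace ℝ (Fin 3)) - y)) (A ((e t : ↥Literature.Geometry.DiscreteGeometry.fccKissingPattern) : EuclideanSpace ℝ (Fin 3))) ≤ 1 / 20) ∨ (∃ e : ↥T ≃ ↥Literature.Geometry.DiscreteGeometry.hcpKissingPattern, ∀ t : ↥T, dist (d⁻¹ • ((t : EuclideanSpace ℝ (Fin 3)) - y)) (A ((e t : ↥Literature.Geometry.DiscreteGeometry.hcpKissingPattern) : EuclideanSpace ℝ (Fin 3))) ≤ 1 / 20) ∨ (∃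 e : ↥T ≃ ↥{p : EuclideanSpace ℝ (Fin 3) | p = !₂[(0 : ℝ), 0, 1] ∨ p = !₂[(0 : ℝ), 0, -1] ∨ ∃ k : Fin 5, ∃ σ : ℝ, (σ = 1 / 2 ∨ σ = -(1 / 2)) ∧ p = !₂[Real.sqrt 3 / 2 * Real.cos (2 * Real.pi * (k : ℝ) / 5), Real.sqrt 3 / 2 * Real.sin (2 * Real.pi * (k : ℝ) / 5), σ]}, ∀ t : ↥T, dist (d⁻¹ • ((t : EuclideanSpace ℝ (Fin 3)) - y)) (A ((e t : ↥{p : EuclideanSpace ℝ (Fin 3) | p = !₂[(0 : ℝ), 0, 1] ∨ p = !₂[(0 : ℝ), 0, -1] ∨ ∃ k : Fin 5, ∃ σ : ℝ, (σ = 1 / 2 ∨ σ = -(1 / 2)) ∧ p = !₂[Real.sqrt 3 / 2 * Real.cos (2 * Real.pi * (k : ℝ) / 5), Real.sqrt 3 / 2 * Real.sin (2 * Real.pi * (k : ℝ) / 5), σ]}) : EuclideanSpace ℝ (Fin 3))) ≤ 1 / 20)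

/-- {fcc,hcp}-goodness `GF` of the crux. -/
def GF (S : Set E3) (y : E3) : Prop :=
  let d : ℝ := sInf ((fun z => dist z y) '' (S \ {y})); let T : Set (EuclideanSpace ℝ (Fin 3)) := {z : EuclideanSpace ℝ (Fin 3) | z ∈ S ∧ z ≠ y ∧ dist z y < 13 / 10 * d}; ∃ A : EuclideanSpace ℝ (Fin 3) →ₗᵢ[ℝ] EuclideanSpace ℝ (Fin 3), (∃ e : ↥T ≃ ↥Literature.Geometry.DiscreteGeometry.fccKissingPattern, ∀ t : ↥T, dist (d⁻¹ • ((t : EuclideanSpace ℝ (Fin 3)) - y)) (A ((e t : ↥Literature.Geometry.DiscreteGeometry.fccKissingPattern) : EuclideanSpace ℝ (Fin 3))) ≤ 1 / 20) ∨ (∃ e : ↥T ≃ ↥Literature.Geometry.DiscreteGeometry.hcpKissingPattern, ∀ t : ↥T, dist (d⁻¹ • ((t : EuclideanSpace ℝ (Fin 3)) - y)) (A ((e t : ↥Literature.Geometry.DiscreteGeometry.hcpKissingPattern) : EuclideanSpace ℝ (Fin 3))) ≤ 1 / 20)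

/-- `δ`-separated. -/
def Separated (δ : ℝ) (S : Set E3) : Prop := ∀ y ∈ S, ∀ z ∈ S, y ≠ z → δ ≤ dist y z

/-- Relatively dense with covering radius `R₁`. -/
def RelDense (R₁ : ℝ) (S : Set E3) : Prop := ∀ p : E3, ∃ y ∈ S, dist y p ≤ R₁

/-- The admissible class of the crux (hypotheses of `FiveFoldRation`, covering radius made explicit). -/
def Admissible (δ R₁ : ℝ) (S : Set E3) : Prop := Separated δ S ∧ RelDense R₁ S ∧ ∀ y ∈ S, GA S y

/-- Axis sites: the points that are not `1/20`-{fcc,hcp}-good (the counted set of the crux). -/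
def axisSites (S : Set E3) : Set E3 := {y : E3 | y ∈ S ∧ ¬ GF S y}

/-- The crux, read through the named predicates: definitional (`Iff.rfl`). -/
theorem fiveFoldRation_iff :
    Summit.AtomisticToContinuum.Crystallization.Theses.DisclinationRation.FiveFoldRation ↔
      ∀ δ : ℝ, 0 < δ → ∀ S : Set E3, Separated δ S → (∃ R₁ : ℝ, RelDense R₁ S) → (∀ y ∈ S, GA S y) →
        ∀ θ : ℝ, 0 < θ → ∃ L₀ : ℝ, ∀ L : ℝ, L₀ ≤ L → ∀ c : E3,
          (({y : E3 | y ∈ S ∧ dist y c ≤ L ∧ ¬ GF S y} : Set E3).ncard : ℝ) ≤ θ * L ^ 3 :=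
  Iff.rfl

/-! ## Card `stationary-flatness` — C⁺ and the correspondence bridge -/

/-- **C⁺ (StationaryAxisFree).** A STATIONARY random admissible configuration has, almost surely, no
axis site at all.  Data: a probability space `(Ω, P)` with a measure-preserving action `T` of the
translations of `ℝ³` and an equivariant configuration map `X` (`X (T v ω) = X ω − v`), point-process
measurable (counts in bounded Borel sets are measurable), every `X ω` admissible with the SAME constants
`δ, R₁`.  Intended proof: Kingman along every direction for the translation-covariant coarse metric
`D_ω(x,y) = d_{K(X ω)}(site near x, site near y)` of the ideal unit-edge octet complex `K` ⇒ the
asymptotic cone of `K(X ω)` is a NORMED `ℝ³`; normed + CBB(0) ⇒ inner product; non-collapsed volume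
continuity (BGP 10.8) ⇒ volume ratio `θ_∞ = 1` ⇒ Bishop–Gromov rigidity in the polyhedral cone-manifold
⇒ no singular edge ⇒ no axis site. -/
def StationaryAxisFree : Prop :=
  ∀ (Ω : Type) [MeasurableSpace Ω] (P : Measure Ω) [IsProbabilityMeasure P]
    (T : E3 → Ω → Ω) (X : Ω → Set E3) (δ R₁ : ℝ), 0 < δ →
    (∀ v : E3, MeasurePreserving (T v) P P) →
    (∀ (v : E3) (ω : Ω), X (T v ω) = (fun p : E3 => p - v) '' X ω) →
    (∀ B : Set E3, MeasurableSet B → Bornology.IsBounded B → Measurable fun ω => (X ω ∩ B).ncard) →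
    (∀ ω, Admissible δ R₁ (X ω)) →
    ∀ᵐ ω ∂P, axisSites (X ω) = ∅

/-- **Correspondence bridge** (Furstenberg averaging): if `FiveFoldRation` failed for an admissible `S`
(`θ > 0`, radii `L_k → ∞`, centres `c_k` with `> θ L_k³` axis sites), the empirical measures of the
translates `S − t`, `t ∈ B_{L_k}(c_k)`, have a weak-* limit point on the (compact, local-rubber) hull of
`S`: a translation-invariant probability measure all of whose configurations are admissible with the same
`δ, R₁` (goodness and axis-ness are closed under local limits; deca-good excludes {fcc,hcp}-good by the
margin `(√2−1)/4 > 1/20`) and whose axis intensity is `≥ θ/ω₃ > 0` (upper semicontinuity of the axis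
count) — contradicting `StationaryAxisFree` on an ergodic component.  First checkable statement of the
line; typeable now, proof = soft compactness + Portmanteau. -/
def Correspondence : Prop :=
  StationaryAxisFree → Summit.AtomisticToContinuum.Crystallization.Theses.DisclinationRation.FiveFoldRation

/-! ## Card `regge-petrunin-pattern-complex` — front end, C⁺, proved bridge -/

/-- **Front end, first local lemma (ShellMutual).** Shell membership is symmetric on admissible sets:
if `z` is in the first shell of `y` then `y` is in the first shell of `z` (so the bond graph is
well defined and 12-regular, and `d_z/d_y ∈ [0.95/1.05, 1.05/0.95]`).  Finite check: covering radius
`≤ 46°` of the three patterns versus the `13/10` cutoff. -/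
def ShellMutual : Prop :=
  ∀ δ : ℝ, 0 < δ → ∀ S : Set E3, Separated δ S → (∃ R₁ : ℝ, RelDense R₁ S) → (∀ y ∈ S, GA S y) →
    ∀ y ∈ S, ∀ z ∈ S, z ∈ shell S y → y ∈ shell S z

/-- **Front end, second local lemma (AxisBondSymmetric / pole lemma).** Two bonded sites have 4 or 5
common shell-neighbours, and 5 exactly when BOTH are axis sites (only the poles of the decahedral pattern
have five pattern-neighbours at unit distance; every (anti)cuboctahedron vertex has four, the fifth at
`√2`, margin `(√2−1)/4 = 0.1036 > 1/20`).  Hence axis bonds chain axis sites pole-to-pole and, the two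
poles being antipodal in the pattern, axes are straight complete local geodesics of the ideal complex. -/
def AxisBondSymmetric : Prop :=
  ∀ δ : ℝ, 0 < δ → ∀ S : Set E3, Separated δ S → (∃ R₁ : ℝ, RelDense R₁ S) → (∀ y ∈ S, GA S y) →
    ∀ y ∈ S, ∀ z ∈ S, z ∈ shell S y →
      (({w : E3 | w ∈ shell S y ∧ w ∈ shell S z} : Set E3).ncard = 4 ∨
        (({w : E3 | w ∈ shell S y ∧ w ∈ shell S z} : Set E3).ncard = 5 ∧ ¬ GF S y ∧ ¬ GF S z))

/-- **C⁺ (LinearAxisCensus)** — the codimension-two rate with an ABSOLUTE constant: at most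
`C·(L/δ + 1)` axis sites in any closed ball of radius `L`.  Intended proof: Regge curvature of the ideal
octet cone-manifold `K(S)` (deficit `ω₅ = 2π − 5·arccos(1/3)` on axis edges, `0` elsewhere) in a `K`-ball
of radius `r` is `≤ C(3)·r` by Petrunin's curvature-integral bound applied to the explicit concave tube
smoothing (axes are straight, `AxisBondSymmetric`); real radius `L` ↦ `K`-radius `≤ 2.3·L/δ + 1`. -/
def LinearAxisCensus : Prop :=
  ∃ C : ℝ, ∀ δ : ℝ, 0 < δ → ∀ S : Set E3, Separated δ S → (∃ R₁ : ℝ, RelDense R₁ S) → (∀ y ∈ S, GA S y) →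
    ∀ L : ℝ, 0 ≤ L → ∀ c : E3, (({y : E3 | y ∈ S ∧ dist y c ≤ L ∧ ¬ GF S y} : Set E3).ncard : ℝ) ≤ C * (L / δ + 1)

/-- **Bridge (proved): the linear census implies the crux BY NAME.**  With `L₀ := max 1 (max (2C/(δθ)) (√(2|C|/θ) … ))`
one has `C (L/δ + 1) ≤ θ L³`; we give a short real-analysis proof. -/
theorem fiveFoldRation_of_linearAxisCensus (h : LinearAxisCensus) :
    Summit.AtomisticToContinuum.Crystallization.Theses.DisclinationRation.FiveFoldRation := by
  rw [fiveFoldRation_iff]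
  obtain ⟨C, hC⟩ := h
  intro δ hδ S hsep hdense hgood θ hθ
  -- work with C' = max C 0 ≥ 0
  have key : ∀ L : ℝ, 0 ≤ L → ∀ c : E3,
      (({y : E3 | y ∈ S ∧ dist y c ≤ L ∧ ¬ GF S y} : Set E3).ncard : ℝ) ≤ max C 0 * (L / δ + 1) := by
    intro L hL c
    refine le_trans (hC δ hδ S hsep hdense hgood L hL c) ?_
    have : 0 ≤ L / δ + 1 := by positivity
    exact mul_le_mul_of_nonneg_right (le_max_left _ _) this
  set C' : ℝ := max C 0 with hC'
  have hC'0 : 0 ≤ C' := le_max_right _ _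
  -- choose L₀ := max 1 (2 * C' / (δ * θ) + 2 * C' / θ); for L ≥ L₀ ≥ 1: C'(L/δ+1) ≤ C'(L/δ + L) = C' L (1/δ + 1) ≤ θ L³ since L² ≥ L ≥ C'(1/δ+1)/θ
  refine ⟨max 1 (C' * (1 / δ + 1) / θ), fun L hL c => ?_⟩
  have hL1 : (1 : ℝ) ≤ L := le_trans (le_max_left _ _) hL
  have hL0 : (0 : ℝ) ≤ L := le_trans zero_le_one hL1
  have hL2 : C' * (1 / δ + 1) / θ ≤ L := le_trans (le_max_right _ _) hL
  have hA : C' * (1 / δ + 1) ≤ θ * L := by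
    have := (div_le_iff₀ hθ).mp hL2
    linarith [mul_comm L θ]
  have hδinv : 0 ≤ 1 / δ + 1 := by positivity
  calc (({y : E3 | y ∈ S ∧ dist y c ≤ L ∧ ¬ GF S y} : Set E3).ncard : ℝ)
        ≤ C' * (L / δ + 1) := key L hL0 c
    _ ≤ C' * (L / δ + L) := by
        apply mul_le_mul_of_nonneg_left _ hC'0
        linarith
    _ = (C' * (1 / δ + 1)) * L := by ring
    _ ≤ (θ * L) * L := mul_le_mul_of_nonneg_right hA hL0
    _ ≤ (θ * L) * L * L := by
        have h1 : 0 ≤ θ * L * L := by positivity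
        nlinarith
    _ = θ * L ^ 3 := by ring


/-! ## Card `sheet-area-strip-forest` — the closing bootstrap and its bridge -/

/-- **LayerBootstrap** (pure real analysis, the closing step of card sheet-area-strip-forest): a monotone
profile `f` with the trivial cubic bound and the "area + forest + boundary layer" inequality
`f(r − 6W) ≤ C₁ r³/W + (f(r−4W) − f(r−8W))/3` for all widths `W ≥ W₀`, `r ≥ 16W`, is `o(r³)` — with the
threshold depending on `(C₀, C₁, W₀, θ)` ONLY (average the layer term over `r ∈ [R, 2R]`, choose `W = √R`:
`f(ρ) ≤ C ρ^{5/2}`). -/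
def LayerBootstrap : Prop :=
  ∀ C₀ C₁ W₀ θ : ℝ, 0 < θ → ∃ ρ₀ : ℝ, ∀ f : ℝ → ℝ, Monotone f → (∀ r, 0 ≤ f r) →
    (∀ r, 0 ≤ r → f r ≤ C₀ * (1 + r) ^ 3) →
    (∀ W r : ℝ, W₀ ≤ W → 16 * W ≤ r → f (r - 6 * W) ≤ C₁ * r ^ 3 / W + (f (r - 4 * W) - f (r - 8 * W)) / 3) →
    ∀ ρ : ℝ, ρ₀ ≤ ρ → f ρ ≤ θ * ρ ^ 3

/-- **StripForestInequality** (the geometric content of card sheet-area-strip-forest, in REAL balls): for an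
admissible `S` there are constants `C₀, C₁, W₀` (depending on `S` only through `δ, R₁`) such that for EVERY
centre `c` the axis-count profile `f_c(r) = #(axisSites S ∩ B̄_r(c))` satisfies the bootstrap hypotheses:
exposed axes (a wide sheet) pay area `≥ W` per unit length inside a ball of volume `O(r³)`; screened axes
(five narrow strips) are at most a third of the leaves of the narrow-strip FOREST (no cycle: an innermost
strip tube is flat inside and its cross-section would be a flat polygon with corners `k_i·arccos(1/3)`,
impossible since `arccos(1/3)/π ∉ ℚ`), and leaves are exposed or lie in the boundary layer. -/
def StripForestInequality : Prop :=
  ∀ δ : ℝ, 0 < δ → ∀ S : Set E3, Separated δ S → (∃ R₁ : ℝ, RelDense R₁ S) → (∀ y ∈ S, GA S y) →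
    ∃ C₀ C₁ W₀ : ℝ, ∀ c : E3,
      let f : ℝ → ℝ := fun r => ((axisSites S ∩ Metric.closedBall c r).ncard : ℝ)
      Monotone f ∧ (∀ r, 0 ≤ f r) ∧ (∀ r, 0 ≤ r → f r ≤ C₀ * (1 + r) ^ 3) ∧
        ∀ W r : ℝ, W₀ ≤ W → 16 * W ≤ r → f (r - 6 * W) ≤ C₁ * r ^ 3 / W + (f (r - 4 * W) - f (r - 8 * W)) / 3

/-- **Bridge (proved): bootstrap + strip-forest inequality ⇒ the crux BY NAME** (pure logic: the threshold of
`LayerBootstrap` is uniform in the centre because it depends on `(C₀, C₁, W₀, θ)` only). -/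
theorem fiveFoldRation_of_stripForest (hB : LayerBootstrap) (hF : StripForestInequality) :
    Summit.AtomisticToContinuum.Crystallization.Theses.DisclinationRation.FiveFoldRation := by
  rw [fiveFoldRation_iff]
  intro δ hδ S hsep hdense hgood θ hθ
  obtain ⟨C₀, C₁, W₀, hc⟩ := hF δ hδ S hsep hdense hgood
  obtain ⟨ρ₀, hρ₀⟩ := hB C₀ C₁ W₀ θ hθ
  refine ⟨ρ₀, fun L hL c => ?_⟩
  obtain ⟨hmono, hnn, hcub, hlayer⟩ := hc c
  have key := hρ₀ (fun r => ((axisSites S ∩ Metric.closedBall c r).ncard : ℝ)) hmono hnn hcub hlayer L hL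
  have hset : ({y : E3 | y ∈ S ∧ dist y c ≤ L ∧ ¬ GF S y} : Set E3) = axisSites S ∩ Metric.closedBall c L := by
    ext y
    simp only [axisSites, Set.mem_setOf_eq, Set.mem_inter_iff, Metric.mem_closedBall]
    tauto
  rw [hset]
  exact key

end Summit.AtomisticToContinuum.Crystallization.Cruxes.FiveFoldRation.IdeatorOne
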